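import Literature.Probability.FitznerVanDerHofstad2017.Stage1Eval
import Literature.Probability.FitznerVanDerHofstad2017.Stage1CellsRec

/-!
# Literature.Probability.FitznerVanDerHofstad2017.Stage1EvalRec — stage 1 on the CELL OF RECORD (`wborbx + wbg2 + hexprint`), real and rational

CITATION HEADER (PLACEMENT v2). Part of the certified REPRODUCTION of R. Fitzner, R. van der Hofstad, *Mean-field
behavior for nearest-neighbor percolation in d > 10*, EJP 22 (2017) no. 43 [FvdH17] (notebook `Percolation.nb`) and
*Generalized approach to the non-backtracking lace expansion*, PTRF 169 (2017) 1041–1119 [NoBLE17]; build `lace`, seat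
lean2 (gen 12), GAPS G8 layer L1′ for REVISION 6 of the cited `d = 11` certificate (`MeanFieldD11Cert`: tuple O12g on
the cell of record `wborbx + wbg2 + hexprint`, REFEREE v34 R-D46c / R-D49, v36 R-D46d).  ADDITIVE companion of
`Stage1Frame.lean` / `Stage1Eval.lean` (nothing there is changed); no numeral of the notebooks, no table, no verdict;
nothing here is a cited fact.

What this module is.  `Stage1Frame.Data.inp` is cell 44 of `Percolation.nb` AS CODED; the certificate of record
evaluates three cells by their PRINTED form instead (HOME/DIVERGENCE.md D46, D34, D49; `MeanFieldD11Cert` header):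
the explicit weighted-bubble pieces with orbit multiplicities / exact weights / own-type sums (`wborbx`, [NoBLE17-I]
§5.3.3) and `Γ̄₂` on their inner K-tails (`wbg2`, [NoBLE17] §5.3.2) — transcribed as `PX` syntax in
`Stage1CellsRec.lean` (namespace `Stage1Cells.Rec`) — and the hexagon exponent of the first lower bound of
[FvdH17-II] Lemma 5.3 (arXiv:1506.07977v1 `Bounds/BoundNOne.tex` l.92, eq. (lemmaLowerbound-1)):
`(1 − p⁵)^{16(d−1)(d−2)(2d−3) − 1}` in `Bound[Pi,alpha,lower,0,s]`, where the notebook (cell 36) has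
`(1 − z_i⁵)^{16(d−1)(d−2) − 1}` (`hexprint`, D49; the class adopts the printed exponent).  This file gives, next to the
coded objects and under new names:

* `Data.K2rec`, `Data.piAlphaLower0Rec` — cell 36's `K₂` / `Bound[Pi,alpha,lower,0,s]` with the PRINTED exponent;
* `Data.inpRec`, `Data.stage1Rec`, `Data.frameRec` — cell 44 / stage 1 / the typed `NoGoFrame.Frame` whose 22 `Δ`-fields
  (every field of cell 44 that reaches `Bound[WeightedBubble,·,·]`: `xiR0Delta … xiIotaRII0DeltaZero`, field list derived
  mechanically from `Stage1Frame.Data.inp`, sha256 ea8c84e9d6158448…) read the `Stage1Cells.Rec` cells and whose `piAlphaLower`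
  reads `piAlphaLower0Rec`; every other field, the three two-point bounds, the validity region `Data.U` and the initial
  cells are those of `Stage1Frame` unchanged (they do not reach the three repaired cells);
* the `Std` theorems for the record frame — `Std.K2rec_nonneg`, `Std.piAlphaLower0Rec_anti`, `Std.monoRec`,
  `Std.nonnegRec`, `Std.hypRec : D.frameRec.Hyp y₀` — with the proofs of `Stage1Frame` verbatim (the cell signs M1–M6
  are properties of `PX` positivity / table order and of `K₂ ≥ 0`, not of the repaired multiplicities);
* the rational mirror `K2recQ`, `DataQ.piAlphaLower0Rec`, `DataQ.inpRrec` (verbatim over `ℚ`, as `Stage1Eval` does for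
  the coded record, sha256 ce5b7fe8afe32d72…) and, under `Data.RatModel D E`, the cast lemmas `Data.K2rec_ratCast`,
  `Data.piAlphaLower0Rec_ratCast`, `Data.inpRec_ratCast : D.inpRec y.cast s = E.inpRrec D.P y s`,
  `Data.inpRec_dom_of_ratModel` / `Data.dom_inpRec_of_ratModel` — the kernel form (`norm_cast; decide +kernel` per
  field) in which an instantiating certificate compares the typed record-cell stage 1 with a numeral `Inputs` record.

VALIDATION (lean2-g12, 2026-08-19; scratch `lean2/g12/work/alpha/`, generator `gen_evalq_rec.py` = lean2-g10's
`gen_evalq.py` pointed at the record switches): at `d = 11`, orders (12,28), `N = 14` counts, the O12g state of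
`MeanFieldD11Cert` and tables := the exact binary values of engine A's FLOAT run (`num1/engineA/noble_model.py` g9,
switches `wb=orbx`, `wbg2=fix`, `hexp=print`, `variant=as-printed`, `osq=nb`, `anonrep=nb`, inputs of kit job j048028
otherwise), `DataQ.inpRrec` agrees with engine A's sixty cell-44 values at BOTH points to relative `1e-12` in BOTH
directions — 4 × 60 kernel inequalities `decide +kernel`, farm rc 0 (`Check_i.lean`, `Check_o.lean`); negative control:
the coded record `DataQ.inpR` fails the same lower comparison at `o` on exactly the 23 changed fields and passes on the
other 37 (`NegCtl_o.lean`).  A transcription check, not a certificate: the certified enclosures enter only in the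
instantiating module.

Scope: cell 44 without the `N ≥ 4` tails, exactly as `Stage1Eval` (the tails `Stage1Tails.inpFull` also reach the
weighted bubble through `hS`, `hE`, `C₁`, `C₂`, …; their record-cell variant is not in this file).  Which tables and
which tuple make the comparison the published one is the instantiating certificate's business
(`MeanFieldD11Stage1EvalRec`).

[cite: FitznerVanDerHofstad2016NoBLE, §5.3.3 and §5.3.2 (5.9) (PTRF 169 pp. 1096–1100)]
-/

namespace Literature.Probability.FitznerVanDerHofstad2017
namespace Stage1Cells

open NoGoFrame F3Bounds BetaMap PX

/-! ## The real side: `K₂` with the printed exponent, cell 44 / stage 1 / frame over the cells of record -/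

namespace Data

variable {ν : Type*} (D : Data ν)

/-- cell 36 constant `K₂` WITH THE PRINTED hexagon exponent: `16(d−1)(d−2)(2d−3) z_i⁶ (1−z_i³)^{2d−2} (1−z_i⁵)^{16(d−1)(d−2)(2d−3)−1}`
(D49 `hexprint`; the coded `Data.K2` has `^{16(d−1)(d−2)−1}`). [cite: FitznerVanDerHofstad2017, Lemma 5.3 of the extended version arXiv:1506.07977v1 (Bounds/BoundNOne.tex l.92, eq. lemmaLowerbound-1); notebook Percolation.nb cell 36] -/
noncomputable def K2rec : ℝ := 16 * (D.dR - 1) * (D.dR - 2) * (2 * D.dR - 3) * D.zIr ^ 6 * (1 - D.zIr ^ 3) ^ (2 * D.P.d - 2)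
  * (1 - D.zIr ^ 5) ^ (16 * (D.P.d - 1) * (D.P.d - 2) * (2 * D.P.d - 3) - 1)

/-- Cell 36 with the printed exponent: `Bound[Pi,alpha,lower,0,s] = K₁ − piAlphaLowSub[s] + K₂rec (1 − piAlphaLowBr[s])`.
[cite: FitznerVanDerHofstad2017, notebook Percolation.nb cell 36 (transcript l.1013–1026); extended version arXiv:1506.07977v1 Lemma 5.3] -/
noncomputable def piAlphaLower0Rec (s : Pt) (y : State) : ℝ :=
  D.K1 - D.ev s y (piAlphaLowSub D.P) + D.K2rec * (1 - D.ev s y (piAlphaLowBr D.P))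

/-- Cell 44 (l.1214–1237) ON THE CELLS OF RECORD: the sixty App. D inputs at point `s` and state `y`, field ↦ `Bound` key
exactly as `Data.inp` (tail-free variant `T″₀`), the 22 `Δ`-fields over `Stage1Cells.Rec` (D46 `wborbx` + D34 `wbg2`) and
`piAlphaLower` with the printed exponent (D49 `hexprint`). [cite: FitznerVanDerHofstad2017, notebook Percolation.nb cell 44 (transcript l.1214–1237)] -/
noncomputable def inpRec (y : State) (s : Pt) : Inputs where
  mu := y.m
  muMin := D.muMin s y
  mubOverMu := D.ev s y mubOverMu
  mub := D.ev s y z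
  xiAlphaOneMinusZeroAtZero := 0
  xiAlphaZeroMinusOneAtZero := 0
  xiAlphaOneMinusZeroAtEi := D.ev s y (XiAlpha10 D.P)
  xiAlphaZeroMinusOneAtEi := D.ev s y (XiAlpha01 D.P)
  xiIotaAlphaIAtEi := D.ev s y (XiIotaAlphaI0 D.P)
  xiIotaAlphaIIAtZero := D.ev s y XiIotaAlphaII0
  xiIotaAlphaISumAroundEi := D.ev s y (XiIotaAlphaISum D.P)
  xiIotaAlphaIISumAroundZero := D.ev s y (XiIotaAlphaIISum D.P)
  psiAlphaIOneMinusZeroAroundEi := D.ev s y (PsiAlphaI10 D.P)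
  psiAlphaIIZeroMinusOneAroundZero := D.psiAlphaII01 s y
  psiAlphaIZeroMinusOneAroundEi := D.psiAlphaI01 s y
  psiAlphaIIOneMinusZeroAroundZero := D.ev s y (PsiAlphaII10 D.P)
  piAlpha := D.ev s y (PiAlpha0 D.P)
  piAlphaLower := D.piAlphaLower0Rec s y
  piOneLower := D.pi1Lower s y
  psiZeroLower := D.psiLower0 s y
  xiAbs := D.ev s y (XiAbs D.P)
  xiOdd := D.ev s y (XiOdd D.P)
  xiEven := D.ev s y (XiEven D.P)
  xiEvenTail := D.ev s y (Xi2 D.P)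
  xiOddTail := D.ev s y (Xi3 D.P)
  xiR0 := D.ev s y (XiR0 D.P)
  xiR1 := D.ev s y (XiR1 D.P)
  xiR0Delta := D.ev s y (Rec.XiR0D D.P)
  xiR1Delta := D.ev s y (Rec.XiR1D D.P)
  xiDeltaAbs := D.ev s y (Rec.XiAbsD D.P)
  xiOddDelta := D.ev s y (Rec.XiOddD D.P)
  xiEvenDelta := D.ev s y (Rec.XiEvenD D.P)
  xiOddTailDelta := D.ev s y (Rec.Xi3D D.P)
  xiEvenTailDelta := D.ev s y (Rec.Xi2D D.P)
  psiRI0 := D.ev s y (PsiRI0 D.P)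
  psiRI1 := D.ev s y (PsiRI1 D.P)
  psiRII0 := D.ev s y (PsiRII0 D.P)
  psiRII1 := D.ev s y (PsiRII1 D.P)
  psiRI0Delta := D.ev s y (Rec.PsiRI0D D.P)
  psiRI1Delta := D.ev s y (Rec.PsiRI1D D.P)
  psiRII0Delta := D.ev s y (Rec.PsiRII0D D.P)
  psiRII1Delta := D.ev s y (Rec.PsiRII1D D.P)
  piR0 := D.ev s y (PiR0 D.P)
  piR0DeltaEiEk := D.ev s y (Rec.PiR0D D.P)
  xiIotaAbs := D.ev s y (XiIotaAbs D.P)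
  xiIotaOdd := D.ev s y (XiIotaOdd D.P)
  xiIotaEven := D.ev s y (XiIotaEven D.P)
  xiIotaEvenTail := D.ev s y (XiIota2 D.P)
  xiIotaRI0 := D.ev s y (XiIotaRI0 D.P)
  xiIotaRII0 := D.ev s y (XiIotaRII0 D.P)
  xiIotaDeltaEi := D.ev s y (Rec.XiIotaAbsDei D.P)
  xiIotaOddDeltaEi := D.ev s y (Rec.XiIotaOddDei D.P)
  xiIotaEvenDeltaEi := D.ev s y (Rec.XiIotaEvenDei D.P)
  xiIotaEvenTailDeltaEi := D.ev s y (Rec.XiIota2Dei D.P)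
  xiIotaDeltaZero := D.ev s y (Rec.XiIotaAbsD0 D.P)
  xiIotaOddDeltaZero := D.ev s y (Rec.XiIotaOddD0 D.P)
  xiIotaEvenDeltaZero := D.ev s y (Rec.XiIotaEvenD0 D.P)
  xiIotaEvenTailDeltaZero := D.ev s y (Rec.XiIota2D0 D.P)
  xiIotaRI0DeltaEi := D.ev s y (Rec.XiIotaRI0Dei D.P)
  xiIotaRII0DeltaZero := D.ev s y (Rec.XiIotaRII0D0 D.P)

/-- STAGE 1 of the typed frame ON THE CELLS OF RECORD (the three two-point bounds are the coded cells 5, 6, 8, unchanged).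
[cite: FitznerVanDerHofstad2017, notebook Percolation.nb cells 3–44] -/
noncomputable def stage1Rec (y : State) : Stage1 where
  inp := D.inpRec y
  G11 := D.ev .o y (G1 D.P 1)
  G22 := D.ev .o y (G2 D.P 2)
  G012 := D.ev .o y (G01 D.P 2)

/-- THE TYPED FRAME ON THE CELLS OF RECORD: `Data.frame` with `S := D.stage1Rec` (validity region `D.U`, initial cells,
`τ`, `n₀ … n₀₀₁` unchanged). [cite: FitznerVanDerHofstad2017, notebook Percolation.nb cells 2–54] -/
noncomputable def frameRec : Frame ν where
  d := D.dR
  τ := D.τ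
  hasT203 := D.hasT203
  codedD20 := D.codedD20
  codedD31 := D.codedD31
  codedD33 := D.codedD33
  printedD36 := D.printedD36
  n0 := D.n0
  n1 := D.n1
  n2 := D.n2
  n3 := D.n3
  n01 := D.n01
  n11 := D.n11
  n001 := D.n001
  S := D.stage1Rec
  U := D.U

/-- The record frame's initial cells are `D.initCell`. [folklore] -/
theorem frameRec_initCell : D.frameRec.initCell = D.initCell := rfl

/-- Cell 44: `mu[s] = m` on the record frame. [folklore] -/
theorem mu_eq_rec (y : State) (s : Pt) : ((D.frameRec.S y).inp s).mu = y.m := rfl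

/-- the record frame has the validity region of the coded one. [folklore] -/
theorem frameRec_U : D.frameRec.U = D.frame.U := rfl

end Data

/-! ## The `Std` theorems for the record frame (proofs verbatim from `Stage1Frame`) -/

namespace Data

variable {ν : Type*} {D : Data ν} {y₀ x y : State}

section Val
variable (H : D.Std y₀)
include H

/-- `K₂rec ≥ 0`. [folklore] -/
theorem Std.K2rec_nonneg : 0 ≤ D.K2rec := by
  have h2 := H.two_le_dR; have hz := H.zIr_nonneg
  have h3 := H.one_sub_zIr_pow_nonneg 3; have h5 := H.one_sub_zIr_pow_nonneg 5
  unfold K2rec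
  apply_rules [mul_nonneg, pow_nonneg] <;> linarith

/-- `Bound[Pi,alpha,lower,0,s]` with the printed exponent is antitone in the state (M3). [folklore] -/
theorem Std.piAlphaLower0Rec_anti (hx : y₀ ≤ x) (hxy : x ≤ y) (hU : D.U y) (s : Pt) :
    D.piAlphaLower0Rec s y ≤ D.piAlphaLower0Rec s x := by
  unfold piAlphaLower0Rec
  have h1 := H.ev_mono hx hxy hU s (piAlphaLowSub D.P)
  have h2 := mul_le_mul_of_nonneg_left (sub_le_sub_left (H.ev_mono hx hxy hU s (piAlphaLowBr D.P)) 1) H.K2rec_nonneg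
  linarith

/-- STAGE 1 ON THE CELLS OF RECORD IS MONOTONE (`Frame.Hyp.mono` for `frameRec`). [folklore] -/
theorem Std.monoRec (hx : y₀ ≤ x) (hxy : x ≤ y) (hU : D.U y) : (D.stage1Rec x).Dom (D.stage1Rec y) := by
  have E := fun s e => H.ev_mono hx hxy hU s e
  refine ⟨fun s => ?_, E .o _, E .o _, E .o _⟩
  constructor
  all_goals first
    | exact E s _
    | exact hxy.2.1
    | exact H.muMin_anti hx hxy s
    | exact H.piAlphaLower0Rec_anti hx hxy hU s
    | exact H.pi1Lower_anti hx hxy hU s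
    | exact H.psiLower0_anti hx hxy hU s
    | exact H.psiAlphaI01_mono hx hxy hU s
    | exact H.psiAlphaII01_mono hx hxy hU s
    | exact le_rfl

/-- STAGE 1 ON THE CELLS OF RECORD HAS THE STRUCTURAL SIGNS on `U` (`Frame.Hyp.nonneg` for `frameRec`). [folklore] -/
theorem Std.nonnegRec (hy : y₀ ≤ y) (hU : D.U y) : (D.stage1Rec y).Nonneg := by
  have E := fun s e => H.ev_nonneg hy hU s e
  refine ⟨fun s => ?_, E .o _, E .o _, E .o _⟩
  constructor
  all_goals first
    | exact E s _
    | exact H.muMin_lt_one hy s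
    | exact H.psiAlphaI01_nonneg hy hU s
    | exact H.psiAlphaII01_nonneg hy hU s
    | exact le_rfl

/-- THE STAGE-1 HYPOTHESES OF THE NO-GO THEOREM FOR THE RECORD FRAME: as `Std.hyp`, every field of
`NoGoFrame.Frame.Hyp y₀` except the floor sign checks is a theorem. [folklore] -/
theorem Std.hypRec (hm : 0 ≤ y₀.m) (hPi : ∀ s, 0 ≤ 1 + (D.frameRec.betaAt y₀ s).βPi) : D.frameRec.Hyp y₀ where
  two_le_d := H.two_le_dR
  tables := H.τ_nonneg
  U_down := fun _ _ hx hxy hU => H.U_down hx hxy hU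
  mono := fun _ _ hx hxy hU => H.monoRec hx hxy hU
  nonneg := fun _ hy hU => H.nonnegRec hy hU
  mu_eq := fun _ _ _ => rfl
  m_floor := hm
  Gamma1_floor := zero_le_one.trans H.one_le_Gamma1
  Gamma2_floor := zero_le_one.trans H.one_le_Gamma2
  onePlusPi_floor := hPi

end Val

end Data

/-! ## The rational side (verbatim over `ℚ`) and the cast lemmas -/

/-- cell 36 constant `K₂` with the printed exponent, over `ℚ` (verbatim `Data.K2rec`). [cite: FitznerVanDerHofstad2017, notebook Percolation.nb cell 36; extended version arXiv:1506.07977v1 Lemma 5.3] -/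
def K2recQ (P : Params) : ℚ := 16 * (dQ P - 1) * (dQ P - 2) * (2 * dQ P - 3) * zIrQ P ^ 6 * (1 - zIrQ P ^ 3) ^ (2 * P.d - 2)
  * (1 - zIrQ P ^ 5) ^ (16 * (P.d - 1) * (P.d - 2) * (2 * P.d - 3) - 1)

namespace DataQ

variable (E : DataQ) (P : Params)

/-- cell 36 `Bound[Pi,alpha,lower,0,s]` with the printed exponent, over `ℚ` (verbatim `Data.piAlphaLower0Rec`). [cite: FitznerVanDerHofstad2017, notebook Percolation.nb cell 36] -/
noncomputable def piAlphaLower0Rec (s : Pt) (y : StateQ) : ℚ :=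
  K1Q P - E.ev P s y (piAlphaLowSub P) + K2recQ P * (1 - E.ev P s y (piAlphaLowBr P))

/-- Cell 44 ON THE CELLS OF RECORD at rational data, as a real record whose sixty entries are casts of rationals (field ↦
cell exactly as `Data.inpRec`). [cite: FitznerVanDerHofstad2017, notebook Percolation.nb cell 44 (transcript l.1214–1237)] -/
noncomputable def inpRrec (y : StateQ) (s : Pt) : Inputs where
  mu := ((y.m : ℚ) : ℝ)
  muMin := ((E.muMin P s y : ℚ) : ℝ)
  mubOverMu := ((E.ev P s y mubOverMu : ℚ) : ℝ)
  mub := ((E.ev P s y z : ℚ) : ℝ)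
  xiAlphaOneMinusZeroAtZero := 0
  xiAlphaZeroMinusOneAtZero := 0
  xiAlphaOneMinusZeroAtEi := ((E.ev P s y (XiAlpha10 P) : ℚ) : ℝ)
  xiAlphaZeroMinusOneAtEi := ((E.ev P s y (XiAlpha01 P) : ℚ) : ℝ)
  xiIotaAlphaIAtEi := ((E.ev P s y (XiIotaAlphaI0 P) : ℚ) : ℝ)
  xiIotaAlphaIIAtZero := ((E.ev P s y XiIotaAlphaII0 : ℚ) : ℝ)
  xiIotaAlphaISumAroundEi := ((E.ev P s y (XiIotaAlphaISum P) : ℚ) : ℝ)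
  xiIotaAlphaIISumAroundZero := ((E.ev P s y (XiIotaAlphaIISum P) : ℚ) : ℝ)
  psiAlphaIOneMinusZeroAroundEi := ((E.ev P s y (PsiAlphaI10 P) : ℚ) : ℝ)
  psiAlphaIIZeroMinusOneAroundZero := ((E.psiAlphaII01 P s y : ℚ) : ℝ)
  psiAlphaIZeroMinusOneAroundEi := ((E.psiAlphaI01 P s y : ℚ) : ℝ)
  psiAlphaIIOneMinusZeroAroundZero := ((E.ev P s y (PsiAlphaII10 P) : ℚ) : ℝ)
  piAlpha := ((E.ev P s y (PiAlpha0 P) : ℚ) : ℝ)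
  piAlphaLower := ((E.piAlphaLower0Rec P s y : ℚ) : ℝ)
  piOneLower := ((E.pi1Lower P s y : ℚ) : ℝ)
  psiZeroLower := ((E.psiLower0 P s y : ℚ) : ℝ)
  xiAbs := ((E.ev P s y (XiAbs P) : ℚ) : ℝ)
  xiOdd := ((E.ev P s y (XiOdd P) : ℚ) : ℝ)
  xiEven := ((E.ev P s y (XiEven P) : ℚ) : ℝ)
  xiEvenTail := ((E.ev P s y (Xi2 P) : ℚ) : ℝ)
  xiOddTail := ((E.ev P s y (Xi3 P) : ℚ) : ℝ)
  xiR0 := ((E.ev P s y (XiR0 P) : ℚ) : ℝ)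
  xiR1 := ((E.ev P s y (XiR1 P) : ℚ) : ℝ)
  xiR0Delta := ((E.ev P s y (Rec.XiR0D P) : ℚ) : ℝ)
  xiR1Delta := ((E.ev P s y (Rec.XiR1D P) : ℚ) : ℝ)
  xiDeltaAbs := ((E.ev P s y (Rec.XiAbsD P) : ℚ) : ℝ)
  xiOddDelta := ((E.ev P s y (Rec.XiOddD P) : ℚ) : ℝ)
  xiEvenDelta := ((E.ev P s y (Rec.XiEvenD P) : ℚ) : ℝ)
  xiOddTailDelta := ((E.ev P s y (Rec.Xi3D P) : ℚ) : ℝ)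
  xiEvenTailDelta := ((E.ev P s y (Rec.Xi2D P) : ℚ) : ℝ)
  psiRI0 := ((E.ev P s y (PsiRI0 P) : ℚ) : ℝ)
  psiRI1 := ((E.ev P s y (PsiRI1 P) : ℚ) : ℝ)
  psiRII0 := ((E.ev P s y (PsiRII0 P) : ℚ) : ℝ)
  psiRII1 := ((E.ev P s y (PsiRII1 P) : ℚ) : ℝ)
  psiRI0Delta := ((E.ev P s y (Rec.PsiRI0D P) : ℚ) : ℝ)
  psiRI1Delta := ((E.ev P s y (Rec.PsiRI1D P) : ℚ) : ℝ)
  psiRII0Delta := ((E.ev P s y (Rec.PsiRII0D P) : ℚ) : ℝ)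
  psiRII1Delta := ((E.ev P s y (Rec.PsiRII1D P) : ℚ) : ℝ)
  piR0 := ((E.ev P s y (PiR0 P) : ℚ) : ℝ)
  piR0DeltaEiEk := ((E.ev P s y (Rec.PiR0D P) : ℚ) : ℝ)
  xiIotaAbs := ((E.ev P s y (XiIotaAbs P) : ℚ) : ℝ)
  xiIotaOdd := ((E.ev P s y (XiIotaOdd P) : ℚ) : ℝ)
  xiIotaEven := ((E.ev P s y (XiIotaEven P) : ℚ) : ℝ)
  xiIotaEvenTail := ((E.ev P s y (XiIota2 P) : ℚ) : ℝ)
  xiIotaRI0 := ((E.ev P s y (XiIotaRI0 P) : ℚ) : ℝ)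
  xiIotaRII0 := ((E.ev P s y (XiIotaRII0 P) : ℚ) : ℝ)
  xiIotaDeltaEi := ((E.ev P s y (Rec.XiIotaAbsDei P) : ℚ) : ℝ)
  xiIotaOddDeltaEi := ((E.ev P s y (Rec.XiIotaOddDei P) : ℚ) : ℝ)
  xiIotaEvenDeltaEi := ((E.ev P s y (Rec.XiIotaEvenDei P) : ℚ) : ℝ)
  xiIotaEvenTailDeltaEi := ((E.ev P s y (Rec.XiIota2Dei P) : ℚ) : ℝ)
  xiIotaDeltaZero := ((E.ev P s y (Rec.XiIotaAbsD0 P) : ℚ) : ℝ)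
  xiIotaOddDeltaZero := ((E.ev P s y (Rec.XiIotaOddD0 P) : ℚ) : ℝ)
  xiIotaEvenDeltaZero := ((E.ev P s y (Rec.XiIotaEvenD0 P) : ℚ) : ℝ)
  xiIotaEvenTailDeltaZero := ((E.ev P s y (Rec.XiIota2D0 P) : ℚ) : ℝ)
  xiIotaRI0DeltaEi := ((E.ev P s y (Rec.XiIotaRI0Dei P) : ℚ) : ℝ)
  xiIotaRII0DeltaZero := ((E.ev P s y (Rec.XiIotaRII0D0 P) : ℚ) : ℝ)

end DataQ

namespace Data

variable {ν : Type*} {D : Data ν} {E : DataQ} (h : D.RatModel E)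
include h

omit h in
/-- `K₂rec` is rational. [folklore] -/
theorem K2rec_ratCast : D.K2rec = ((K2recQ D.P : ℚ) : ℝ) := by
  simp only [Data.K2rec, K2recQ, Data.zIr, zIrQ, Data.dR, dQ]; push_cast; all_goals rfl

/-- cell 36 with the printed exponent is the cast of the rational one. [folklore] -/
theorem piAlphaLower0Rec_ratCast (s : Pt) (y : StateQ) :
    D.piAlphaLower0Rec s y.cast = ((E.piAlphaLower0Rec D.P s y : ℚ) : ℝ) := by
  simp only [Data.piAlphaLower0Rec, DataQ.piAlphaLower0Rec, ev_ratCast h, K1_ratCast, K2rec_ratCast]; push_cast; all_goals rfl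

/-- CELL 44 ON THE CELLS OF RECORD AT RATIONAL DATA: field by field the cast of its rational value. [folklore] -/
theorem inpRec_ratCast (y : StateQ) (s : Pt) : D.inpRec y.cast s = E.inpRrec D.P y s := by
  simp only [Data.inpRec, DataQ.inpRrec, ev_ratCast h, muMin_ratCast h, piAlphaLower0Rec_ratCast h, psiLower0_ratCast h,
    pi1Lower_ratCast h, psiAlphaI01_ratCast h, psiAlphaII01_ratCast h, StateQ.cast_m]

/-- kernel form of an upper comparison for the record-cell stage 1. [folklore] -/
theorem inpRec_dom_of_ratModel {y : StateQ} {s : Pt} {N : Inputs} (hN : (E.inpRrec D.P y s).Dom N) :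
    (D.inpRec y.cast s).Dom N := by
  rw [inpRec_ratCast h]; exact hN

/-- kernel form of a lower comparison for the record-cell stage 1. [folklore] -/
theorem dom_inpRec_of_ratModel {y : StateQ} {s : Pt} {N : Inputs} (hN : N.Dom (E.inpRrec D.P y s)) :
    N.Dom (D.inpRec y.cast s) := by
  rw [inpRec_ratCast h]; exact hN

end Data

end Stage1Cells
end Literature.Probability.FitznerVanDerHofstad2017
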